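/-
Copyright (c) 2026 the pub-hodgecm-mathlib formalisation cell (harness21).  Prover seat hodgecm-mathlib-K2Liu-p05 (g7), Track B «K2-LIT»,
#184♮ = hLiu418 = `stmt-HodgeConjecture-24832`; socket #42S ∕ (S5-c), organ (M) of LEAD F0P6-plan (g14) RULING M-158h (c) ∕ BATCH #66 (2):
the MIDDLE-CELL CENTRAL-RAY LAW on the convergence half-plane.
-/
import Summits.HodgeConjecture.HodgeConjecture.Theorems.K2LiuSiegelMiddleTermIdentification   -- ★ I4 ED. 3 (+ ★ α3-2 `middle_cell_eq_tsum`, ★ (H) `lintegral_tsum_enorm_mul_weight_ne_top`, ★ `measurePreserving_conj_levi`)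
import Summits.HodgeConjecture.HodgeConjecture.Theorems.K2LiuSiegelMiddleTermInnerFamily     -- ★ I1 `inner_section_torus_law` (+ ★ C-part `inner_section_unfold`)
import Summits.HodgeConjecture.HodgeConjecture.Theorems.K2LiuMiddleTermRowSection           -- ★ `exists_rowSection₂`
import Summits.HodgeConjecture.HodgeConjecture.Theorems.K2LiuSiegelQuotSubgroupOrbitSum      -- ★ F4-2c `exists_section_of_orbit` (a section of `Stab\N_Δ(L⁺)`)
import Summits.HodgeConjecture.HodgeConjecture.Theorems.K2LiuSingularSectionVanishes        -- ★ S5-W4 `modDelta_of_blk_eq_levi_scalar`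
import Literature.NumberTheory.Automorphic.DoubledUnitaryRankOneReductionRay                 -- ★ `conjAdele_posRealIdele`
import Literature.NumberTheory.Automorphic.IdeleClassGroupProofs                             -- ★ `ideleNorm_posRealIdele_holds`
import HarnessLib

/-!
# Crux `HLiu418`, socket #42S ∕ (S5-c), organ (M) — `K2LiuSiegelMiddleTermCentralRay`: THE MIDDLE CELL OF THE CONSTANT TERM IS A CENTRAL-RAY EIGENFUNCTION,
# `MID_s(m(z(r)·1) · h) = |z(r)|_𝔸 · MID_s(h) = modΔ(m(z(r)·1))¹ · MID_s(h)` on `1 < re s` (`n = 2`; exponent `1` of the table «3 ∣ 1 ∣ 1»)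

Cell `hodgecm-mathlib`, crux item hLiu418 = `stmt-HodgeConjecture-24832`; squad K2 ∕ K2Liu; LEAD F0P6-plan (g14) RULING M-158h (c) «NEW ORGAN (M)» ∕ BATCH #66 (2)
«(M) MOVES to K2Liu-p05 (g7)»; consumer F0P2-p09 (g0) ((S5-c) payer `K2LiuIncoherentConstantTermLetters`, letter `hrayM`).  THEOREMS ONLY (no `def`, no instance, no
notation, no named-fact hypothesis, no `sorry`); lane `--supports stmt-HodgeConjecture-24832 --as helper` (count-neutral helper; closes no socket by itself).

THE MATHEMATICS [MoeglinWaldspurger1995, II.1.7], [KudlaRallis1994, §2 (2.10)–(2.12)], [GelbartPiatetskishapiroRallis1987, Part A §§1–2].  `n = 2`, frame `e : Fin N × Fin M ≃ Fin 2`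
LITERAL (★ α3-2's currency).  The middle term of record (★ I4 `exists_middleTerm_package'` clause (iii)) is the weighted orbit integral
  `MID_s(h) = ∫ β(u) • Σ'_{q ∈ REST} f_s(γ_q·(u·h)) dνN(u)`,  `REST = (⟦1⟧ ∪ ⟦w_Δ N_Δ(L⁺)⟧)ᶜ`.
By ★ α3-2 `middle_cell_eq_tsum` it is the `GL₂`-Borel sum `Σ'_{q ∈ ℙ¹(L)} F(Λ γ̂_q · h)` of the inner section `F(x) = ∫ β₁(u) • f(w₀·(u·x)) dνN(u)` (`β₁` ANY `Γ₀ = Stab(⟦w₀⟧)`-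
weight); by ★ C-part `inner_section_unfold` `F(y) = C · ∫ f(w₀ n₂(t) y) dμ(t)` along the corner line, so ★ I1 `inner_section_torus_law` gives
`F(Λ(diag(d₀,d₁))·y) = χ(d₀ d̄₁⁻¹)·|d₀|^{s+1}|d₁|^{−s}·F(y)`; at the CENTRAL element `d = (z(r), z(r))` of the ray (`z̄(r) = z(r)`, ★ `conjAdele_posRealIdele`) this is
`F(m_z y) = |z(r)|_𝔸 · F(y)`, and `m_z = Λ(z·1)` commutes with every `Λ γ̂_q`, whence **`MID_s(m_z h) = |z(r)|_𝔸 · MID_s(h)`** — an `s`-INDEPENDENT eigenvalue, equal to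
`modΔ(m_z) = √|z²|_𝔸` (★ S5-W4 `modDelta_of_blk_eq_levi_scalar`): the exponent `1` of F0P2-p09's table «`χ(z)modΔ^{2s+n} ∣ modΔ¹ ∣ χʷ(z)modΔ^{n−2s}`» = «3 ∣ 1 ∣ 1» at `s = ½`.
(The orbit-sum road of ★ F1b-ray does not transfer to the middle cell — `γ_q m_z` is not `m_z γ_{q'}` — the unfolded road does.)
* §1 `levi_scalar_eq_of_blk_eq` — any `p ∈ H(𝔸)` whose block matrix is the scalar Levi matrix `diag(z·1, z⁻¹·1)` (★ W4-ray's ∕ ★ F1b-ray's `hp` letter) with `z̄ = z` IS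
  `Λ(z·1)` (★ `blk_injective`); `mul_glDiagonal_const_comm`, `levi_mul_scalar_mul` — `Λ γ̂ · Λ(z·1) · y = Λ(z·1) · (Λ γ̂ · y)`.
* §2 **`innerSection_centralRay`** — `F(Λ(z(r)·1) · y) = |z(r)|_𝔸 · F(y)` for α3-2's inner section (ANY stabiliser weight `β₁`, ANY Haar `νN`, ANY Siegel section).
* §3a `middleTerm_centralRay_of_weight` — the head with α3-2's letters `β₁ hβ₁ γ hγ` BY VALUE (the I4 tie holds them); §3 **`middleTerm_centralRay`** — THE HEAD: for `νN` Haar, `β` an `N_Δ(L⁺)`-weight of finite mass with `β ≤ 𝟙_K` (`K` compact), `χ` unitary, `1 < re s`, `f ∈ I_Δ(s,χ)`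
  continuous, `r : ℝ≥0ˣ` and ANY `p` with `blk p = diag(z(r)·1, z(r)⁻¹·1)` (★ W4-ray `eq_zero_of_isSiegelDeltaSection_add_centralRay_eigen`'s `h₂` quantifier at `n = 2`):
  `MID_s(p·h) = |z(r)|_𝔸 · MID_s(h)`; **`middleTerm_centralRay_modDelta`** — the same with eigenvalue `modΔ(p)` (exponent 1); `modDelta_centralRay_two` — `modΔ(p) = |z(r)|_𝔸`.
* §4 **`middleContinuation_centralRay`** — family form `∀ s, 1 < re s → ∀ r p, hp → ∀ h, E₇ s (p·h) = |z(r)|_𝔸 · E₇ s h` for `f : ℂ → H(𝔸) → ℂ` and ANY `E₇` agreeing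
  with `(∏_{p ∈ {½}} (s − p)) · MID_s` on `1 < re s` (★ I4 clause (iii) read at `n = 2`) — the `hrayM` letter of the (S5-c) payer on the half-plane.
HONEST LABEL.  Count-neutral helper; it retires nothing by itself: `HC_CM` is proved only modulo the 7 printed citations (2 remaining named inputs:
hLiu418 = `stmt-HodgeConjecture-24832`, h413 = `stmt-HodgeConjecture-24833`) until rung 0 closes.

References: [MoeglinWaldspurger1995, II.1.6–II.1.7]; [KudlaRallis1994, §2 (2.10)–(2.12)]; [GelbartPiatetskishapiroRallis1987, Part A §§1–2]; [HarrisKudlaSweet1996, §1 (1.11)–(1.15)];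
[JiangWu2016ChiB, Prop. 4.1].
-/

set_option autoImplicit false
set_option linter.dupNamespace false -- the mandated namespace repeats `HodgeConjecture.HodgeConjecture`

noncomputable section

open scoped Matrix ENNReal NNReal
open NumberField IsDedekindDomain MeasureTheory MeasureTheory.Measure Filter Set Function
open Literature.NumberTheory.Automorphic Literature.NumberTheory.Automorphic.UnitaryGroup Literature.NumberTheory.GaloisRepresentations
open Literature.NumberTheory.GelbartRogawski1991 Literature.NumberTheory.GelbartRogawski1991.GRConstruction
open Literature.NumberTheory.GelbartRogawski1991.AdaptedBlocks
open Literature.NumberTheory.K2Lit.SiegelDoubled Literature.MeasureTheory.Group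
open UnitaryDualPair
open Summit.HodgeConjecture.HodgeConjecture.Cruxes.HLiu418.K2LiuSiegelMiddleCellLeviCriterion (row_ne_zero)
open Summit.HodgeConjecture.HodgeConjecture.Cruxes.HLiu418.K2LiuSiegelRationalLeviDecomposition (conj_levi_mem_unipDelta)
open Summit.HodgeConjecture.HodgeConjecture.Cruxes.HLiu418.K2LiuConstantTermMiddleCellGL2 (middle_cell_eq_tsum)
open Summit.HodgeConjecture.HodgeConjecture.Cruxes.HLiu418.K2LiuSiegelEisensteinConstantTermFiniteness (lintegral_tsum_enorm_mul_weight_ne_top)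
open Summit.HodgeConjecture.HodgeConjecture.Cruxes.HLiu418.K2LiuUnipDeltaConjMeasurePreserving (measurePreserving_conj_levi)
open Summit.HodgeConjecture.HodgeConjecture.Cruxes.HLiu418.K2LiuSiegelMiddleTermInnerFamily (inner_section_torus_law)
open Summit.HodgeConjecture.HodgeConjecture.Cruxes.HLiu418.K2LiuUnipDeltaCornerUnfoldC (inner_section_unfold)
open Summit.HodgeConjecture.HodgeConjecture.Cruxes.HLiu418.K2LiuMiddleTermRowSection (exists_rowSection₂)
open Summit.HodgeConjecture.HodgeConjecture.Cruxes.HLiu418.K2LiuSiegelQuotSubgroupOrbitSum (exists_section_of_orbit)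
open Summit.HodgeConjecture.HodgeConjecture.Cruxes.HLiu418.K2LiuSiegelBruhatMiddleCellDelta (iotaGG_one_mem_ratH)
open Summit.HodgeConjecture.HodgeConjecture.Cruxes.HLiu418.K2LiuSiegelDoubledBlkUnitary (blk_injective)
open Summit.HodgeConjecture.HodgeConjecture.Cruxes.HLiu418.K2LiuSiegelDoubledLeviMatrix (isUnit_det_gramRA)
open Summit.HodgeConjecture.HodgeConjecture.Cruxes.HLiu418.K2LiuSiegelDoubledUnfold (countable_ratH)
open Summit.HodgeConjecture.HodgeConjecture.Cruxes.HLiu418.K2LiuSingularSectionVanishes (modDelta_of_blk_eq_levi_scalar)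
open Summit.HodgeConjecture.HodgeConjecture.Cruxes.HLiu418.K2LiuMiddleInnerSectionBorelLaw (ideleNorm_coe_pos)

namespace Summit.HodgeConjecture.HodgeConjecture.Cruxes.HLiu418.K2LiuSiegelMiddleTermCentralRay

variable {L : Type} [Field L] [NumberField L] [IsCMField L]

/-! ## The `n = 2` datum (★ α3-2's ∕ ★ I4 ED. 3's variable block VERBATIM) -/

section Two

variable {N M : ℕ} {e : Fin N × Fin M ≃ Fin 2}
  {dV : Fin N → L} {hdV : ∀ i, IsCMField.complexConj L (dV i) = dV i}
  {dW : Fin M → L} {hdW : ∀ i, IsCMField.complexConj L (dW i) = dW i}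
variable [MeasurableSpace (unipDelta L e dV hdV dW hdW)] [BorelSpace (unipDelta L e dV hdV dW hdW)]

variable {g₀ : UnitaryGroup.rationalPair (Fp L) L (IsCMField.complexConj L) N M (Matrix.diagonal dV) (Matrix.diagonal dW)}
  (hg₀ : ((g₀ : GL (Fin N × Fin M) L) : Matrix (Fin N × Fin M) (Fin N × Fin M) L) = Matrix.diagonal (fun k => 1 - 2 * (![0, 1] : Fin 2 → L) (e k)))
  (Λ : GL (Fin 2) (AdeleRing (𝓞 L) L) →* HA L e dV hdV dW hdW)
  (hΛ : ∀ g : GL (Fin 2) (AdeleRing (𝓞 L) L), blk L e dV hdV dW hdW (Λ g) =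
    cayR (AdeleRing (𝓞 L) L) (Fin 2) * Matrix.fromBlocks (g : Matrix (Fin 2) (Fin 2) (AdeleRing (𝓞 L) L)) 0 0
      (((gramR L e dV hdV dW hdW).map ((algebraMap L (AdeleRing (𝓞 L) L)).comp (algebraMap (Fp L) L)))⁻¹ *
        (((g⁻¹ : GL (Fin 2) (AdeleRing (𝓞 L) L)) : Matrix (Fin 2) (Fin 2) (AdeleRing (𝓞 L) L)).map
          (conjAdele (Fp L) L (IsCMField.complexConj L)))ᵀ *
        (gramR L e dV hdV dW hdW).map ((algebraMap L (AdeleRing (𝓞 L) L)).comp (algebraMap (Fp L) L))) *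
      cayRinv (AdeleRing (𝓞 L) L) (Fin 2))
  (Γ₀ : Subgroup (unipDelta L e dV hdV dW hdW))
  (hΓ₀ : ∀ u : unipDelta L e dV hdV dW hdW, u ∈ Γ₀ ↔ (u : HA L e dV hdV dW hdW) ∈ ratH L e dV hdV dW hdW ∧
    IsSiegelDelta L e dV hdV dW hdW (iotaGG L e dV hdV dW hdW (1, UnitaryGroup.rationalPairToAdelic (Fp L) L (IsCMField.complexConj L) N M (Matrix.diagonal dV) (Matrix.diagonal dW) g₀) * (u : HA L e dV hdV dW hdW) * (iotaGG L e dV hdV dW hdW (1, UnitaryGroup.rationalPairToAdelic (Fp L) L (IsCMField.complexConj L) N M (Matrix.diagonal dV) (Matrix.diagonal dW) g₀))⁻¹))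
  (wq : unipDeltaRat L e dV hdV dW hdW → ratH L e dV hdV dW hdW)
  (hwq : ∀ ν, ((wq ν : ratH L e dV hdV dW hdW) : HA L e dV hdV dW hdW) =
    weylDelta L e dV hdV dW hdW * ((ν : unipDelta L e dV hdV dW hdW) : HA L e dV hdV dW hdW))

/-! ## §1 The scalar Levi element of the ray is `Λ(z·1)`; it commutes with the Levi images -/

omit [MeasurableSpace (unipDelta L e dV hdV dW hdW)] [BorelSpace (unipDelta L e dV hdV dW hdW)] in
include hΛ in
/-- **ANY `p ∈ H(𝔸)` WITH THE SCALAR LEVI BLOCK MATRIX `diag(z·1, z⁻¹·1)` IS `Λ(z·1)`** when `z̄ = z` (the `hp` letter of ★ W4-ray ∕ ★ F1b-ray; `blk` is injective ★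
`blk_injective`, and `blk Λ(z·1) = diag(z·1, T⁻¹ (z̄⁻¹·1)ᵀ T) = diag(z·1, z⁻¹·1)` since `T_𝔸` is invertible ★ `isUnit_det_gramRA`).
[cite: HarrisKudlaSweet1996, §1 (1.11)] [cite: MoeglinWaldspurger1995, I.2.1] -/
theorem levi_scalar_eq_of_blk_eq (hdV0 : ∀ i, dV i ≠ 0) (hdW0 : ∀ i, dW i ≠ 0) {z : (AdeleRing (𝓞 L) L)ˣ}
    (hz : conjAdele (Fp L) L (IsCMField.complexConj L) (z : AdeleRing (𝓞 L) L) = z) {p : HA L e dV hdV dW hdW}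
    (hp : blk L e dV hdV dW hdW p =
      cayR (AdeleRing (𝓞 L) L) (Fin 2) *
        Matrix.fromBlocks ((z : AdeleRing (𝓞 L) L) • (1 : Matrix (Fin 2) (Fin 2) (AdeleRing (𝓞 L) L))) 0 0
          (((z⁻¹ : (AdeleRing (𝓞 L) L)ˣ) : AdeleRing (𝓞 L) L) • (1 : Matrix (Fin 2) (Fin 2) (AdeleRing (𝓞 L) L))) *
        cayRinv (AdeleRing (𝓞 L) L) (Fin 2)) :
    p = Λ (glDiagonal 2 (AdeleRing (𝓞 L) L) (fun _ => z)) := by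
  refine blk_injective L e dV hdV dW hdW ?_
  have hT := isUnit_det_gramRA L e dV hdV dW hdW hdV0 hdW0
  have hzi : conjAdele (Fp L) L (IsCMField.complexConj L) (((z⁻¹ : (AdeleRing (𝓞 L) L)ˣ) : AdeleRing (𝓞 L) L)) = ((z⁻¹ : (AdeleRing (𝓞 L) L)ˣ) : AdeleRing (𝓞 L) L) := by
    refine Units.eq_inv_of_mul_eq_one_left ?_
    nth_rw 1 [← hz]
    rw [← map_mul, Units.mul_inv, map_one]
  have hg : ((glDiagonal 2 (AdeleRing (𝓞 L) L) (fun _ => z) : GL (Fin 2) (AdeleRing (𝓞 L) L)) : Matrix (Fin 2) (Fin 2) (AdeleRing (𝓞 L) L)) =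
      (z : AdeleRing (𝓞 L) L) • (1 : Matrix (Fin 2) (Fin 2) (AdeleRing (𝓞 L) L)) := by
    rw [coe_glDiagonal, Matrix.smul_one_eq_diagonal]
  have hgi : (((glDiagonal 2 (AdeleRing (𝓞 L) L) (fun _ => z))⁻¹ : GL (Fin 2) (AdeleRing (𝓞 L) L)) : Matrix (Fin 2) (Fin 2) (AdeleRing (𝓞 L) L)) =
      Matrix.diagonal (fun _ => (((z⁻¹ : (AdeleRing (𝓞 L) L)ˣ) : AdeleRing (𝓞 L) L))) := by
    rw [← map_inv, coe_glDiagonal]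
    rfl
  rw [hp, hΛ, hg, hgi, Matrix.diagonal_map (map_zero _), Matrix.diagonal_transpose]
  simp only [hzi]
  rw [← Matrix.smul_one_eq_diagonal, Matrix.mul_smul, Matrix.mul_one, Matrix.smul_mul, Matrix.nonsing_inv_mul _ hT]

omit [IsCMField L] in
/-- scalar matrices are central in `GL₂(𝔸_L)`: `g · (z·1) = (z·1) · g`. [folklore] -/
theorem mul_glDiagonal_const_comm (g : GL (Fin 2) (AdeleRing (𝓞 L) L)) (z : (AdeleRing (𝓞 L) L)ˣ) :
    g * glDiagonal 2 (AdeleRing (𝓞 L) L) (fun _ => z) = glDiagonal 2 (AdeleRing (𝓞 L) L) (fun _ => z) * g := by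
  refine Units.ext ?_
  rw [Units.val_mul, Units.val_mul, coe_glDiagonal, ← Matrix.smul_one_eq_diagonal, Matrix.mul_smul, Matrix.mul_one, Matrix.smul_mul, Matrix.one_mul]

omit [MeasurableSpace (unipDelta L e dV hdV dW hdW)] [BorelSpace (unipDelta L e dV hdV dW hdW)] in
/-- `Λ g · Λ(z·1) · y = Λ(z·1) · (Λ g · y)`. [folklore] -/
theorem levi_mul_scalar_mul (g : GL (Fin 2) (AdeleRing (𝓞 L) L)) (z : (AdeleRing (𝓞 L) L)ˣ) (y : HA L e dV hdV dW hdW) :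
    Λ g * (Λ (glDiagonal 2 (AdeleRing (𝓞 L) L) (fun _ => z)) * y) = Λ (glDiagonal 2 (AdeleRing (𝓞 L) L) (fun _ => z)) * (Λ g * y) := by
  rw [← mul_assoc, ← mul_assoc, ← map_mul, ← map_mul, mul_glDiagonal_const_comm]

/-! ## §2 The inner section of the middle cell is a central-ray eigenfunction with eigenvalue `|z(r)|_𝔸` -/

include hg₀ hΛ hΓ₀ in
/-- **(M) §2 — `F(Λ(z(r)·1) · y) = |z(r)|_𝔸 · F(y)` FOR α3-2's INNER SECTION** `F(x) = ∫ β₁(u) • f(w₀·(u·x)) dνN(u)` (`νN` ANY Haar measure on `N_Δ(𝔸)`, `β₁` ANY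
`Γ₀ = Stab(⟦w₀⟧)`-weight, `f ∈ I_Δ(s,χ)` continuous): ★ C-part `inner_section_unfold` (the corner-line unfolding `F(y) = C·∫ f(w₀ n₂(t) y) dμ(t)`, `μ` an additive Haar measure
on `𝔸_{L⁺}` built here) and ★ I1 `inner_section_torus_law` at the central `d = (z(r), z(r))`: `χ(z z̄⁻¹) = χ(1) = 1` (★ `conjAdele_posRealIdele`) and `|z|^{s+1}·|z|^{−s} = |z|`.
[cite: MoeglinWaldspurger1995, II.1.7] [cite: KudlaRallis1994, §2 (2.10)–(2.12)] [cite: GelbartPiatetskishapiroRallis1987, Part A §2] -/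
theorem innerSection_centralRay (hdV0 : ∀ i, dV i ≠ 0) (hdW0 : ∀ i, dW i ≠ 0) (νN : Measure (unipDelta L e dV hdV dW hdW)) [νN.IsHaarMeasure]
    {β₁ : unipDelta L e dV hdV dW hdW → ℝ≥0∞} (hβ₁ : IsCoveringWeight Γ₀ β₁)
    {χ : HeckeCharacter L} {s : ℂ} {f : HA L e dV hdV dW hdW → ℂ} (hf : IsSiegelDeltaSection L e dV hdV dW hdW χ s f) (hfc : Continuous f)
    (F : HA L e dV hdV dW hdW → ℂ)
    (hF : ∀ x, F x = ∫ u, (β₁ u).toReal • f (iotaGG L e dV hdV dW hdW (1, UnitaryGroup.rationalPairToAdelic (Fp L) L (IsCMField.complexConj L) N M (Matrix.diagonal dV) (Matrix.diagonal dW) g₀) * ((u : HA L e dV hdV dW hdW) * x)) ∂νN)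
    (r : ℝ≥0ˣ) (y : HA L e dV hdV dW hdW) :
    F (Λ (glDiagonal 2 (AdeleRing (𝓞 L) L) (fun _ => posRealIdele L r)) * y) = ((IdeleClassGroup.ideleNorm L (posRealIdele L r) : ℝ) : ℂ) * F y := by
  -- an additive Haar measure on `𝔸_{L⁺}` (Borel structure built here; the conclusion mentions neither)
  letI : MeasurableSpace (AdeleRing (𝓞 (Fp L)) (Fp L)) := borel _
  haveI : BorelSpace (AdeleRing (𝓞 (Fp L)) (Fp L)) := ⟨rfl⟩
  haveI : LocallyCompactSpace (AdeleRing (𝓞 (Fp L)) (Fp L)) := locallyCompactSpace_adeleRing' (Fp L)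
  -- the corner-line unfolding of the inner section (★ C-part) and the torus law at the central element (★ I1)
  obtain ⟨n₂, C, -, -, -, -, hn₂mem, hn₂X, -, hunf⟩ :=
    inner_section_unfold L e dV hdV dW hdW hg₀ Λ hΛ hdV0 hdW0 νN (Measure.addHaar : Measure (AdeleRing (𝓞 (Fp L)) (Fp L)))
  have hunfold := (hunf Γ₀ hΓ₀ β₁ hβ₁ χ s f hf hfc).2 F hF
  rw [inner_section_torus_law L e dV hdV dW hdW hg₀ Λ hΛ hdV0 hdW0 (Measure.addHaar : Measure (AdeleRing (𝓞 (Fp L)) (Fp L))) n₂ hn₂mem hn₂X χ s f hf F _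
    hunfold (fun _ => posRealIdele L r) y]
  -- the scalar: `χ(z · z̄⁻¹) = 1` and `|z|^{s+1} · |z|^{-s} = |z|`
  have hσz : Units.map (conjAdele (Fp L) L (IsCMField.complexConj L) : AdeleRing (𝓞 L) L →* AdeleRing (𝓞 L) L) (posRealIdele L r) = posRealIdele L r :=
    Units.ext (DoubledUnitary.RankOneReduction.conjAdele_posRealIdele (Fp L) L (IsCMField.complexConj L) r)
  have ht : ((IdeleClassGroup.ideleNorm L (posRealIdele L r) : ℝ) : ℂ) ≠ 0 := by exact_mod_cast (ideleNorm_coe_pos (posRealIdele L r)).ne'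
  rw [map_inv, hσz, mul_inv_cancel, map_one, Units.val_one, one_mul, ← Complex.cpow_add _ _ ht, show s + 1 + -s = 1 by ring, Complex.cpow_one]

/-! ## §3 THE HEAD: the middle term is a central-ray eigenfunction with eigenvalue `|z(r)|_𝔸 = modΔ(m(z(r)·1))` -/

include hwq hg₀ hΛ hΓ₀ in
/-- **(M) §3a — THE MIDDLE-CELL CENTRAL-RAY LAW, WITH A STABILISER WEIGHT AND A ROW SECTION IN HAND** (★ α3-2's own letters `β₁ hβ₁ γ hγ` BY VALUE — the I4 tie
holds them; §3 below discharges them).  `νN` Haar, `β` an `N_Δ(L⁺)`-weight with `∫⁻ β < ∞`, `β ≤ 𝟙_K` (`K` compact), `χ` unitary, `1 < re s`, `f ∈ I_Δ(s,χ)` continuous,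
`r : ℝ≥0ˣ`, `blk p = diag(z(r)·1, z(r)⁻¹·1)`: `MID_s(p·h) = |z(r)|_𝔸 · MID_s(h)` — ★ α3-2 `middle_cell_eq_tsum` at `p·h` and at `h` (its (H) letter ★
`lintegral_tsum_enorm_mul_weight_ne_top`, its `hconj` ★ `measurePreserving_conj_levi`), §1 and §2 term by term.
[cite: MoeglinWaldspurger1995, II.1.7] [cite: KudlaRallis1994, §2 (2.10)–(2.12)] [cite: JiangWu2016ChiB, Prop. 4.1] -/
theorem middleTerm_centralRay_of_weight (hdV0 : ∀ i, dV i ≠ 0) (hdW0 : ∀ i, dW i ≠ 0) (νN : Measure (unipDelta L e dV hdV dW hdW)) [νN.IsHaarMeasure]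
    {β : unipDelta L e dV hdV dW hdW → ℝ≥0∞} (hβ : IsCoveringWeight (unipDeltaRat L e dV hdV dW hdW) β) (hβtop : ∫⁻ u, β u ∂νN ≠ ∞)
    {K : Set (unipDelta L e dV hdV dW hdW)} (hK : IsCompact K) (hβK : ∀ u, β u ≤ K.indicator 1 u)
    {χ : HeckeCharacter L} (hχ : χ.IsUnitary) {s : ℂ} (hs : 1 < s.re) {f : HA L e dV hdV dW hdW → ℂ} (hf : IsSiegelDeltaSection L e dV hdV dW hdW χ s f) (hfc : Continuous f)
    {β₁ : unipDelta L e dV hdV dW hdW → ℝ≥0∞} (hβ₁ : IsCoveringWeight Γ₀ β₁)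
    (γ : Projectivization L (Fin 2 → L) → GL (Fin 2) L)
    (hγ : ∀ p, Projectivization.mk L ((γ p : Matrix (Fin 2) (Fin 2) L) 1) (row_ne_zero (γ p) 1) = p)
    (r : ℝ≥0ˣ) {p : HA L e dV hdV dW hdW}
    (hp : blk L e dV hdV dW hdW p =
      cayR (AdeleRing (𝓞 L) L) (Fin 2) *
        Matrix.fromBlocks (((posRealIdele L r : (AdeleRing (𝓞 L) L)ˣ) : AdeleRing (𝓞 L) L) • (1 : Matrix (Fin 2) (Fin 2) (AdeleRing (𝓞 L) L))) 0 0
          ((((posRealIdele L r)⁻¹ : (AdeleRing (𝓞 L) L)ˣ) : AdeleRing (𝓞 L) L) • (1 : Matrix (Fin 2) (Fin 2) (AdeleRing (𝓞 L) L))) *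
        cayRinv (AdeleRing (𝓞 L) L) (Fin 2))
    (h : HA L e dV hdV dW hdW) :
    ∫ u, (β u).toReal •
        (∑' q : ↥(({Quotient.mk (MulAction.orbitRel (siegelDeltaRat L e dV hdV dW hdW) (ratH L e dV hdV dW hdW)) 1} ∪
            Set.range (fun ν : unipDeltaRat L e dV hdV dW hdW =>
              (Quotient.mk (MulAction.orbitRel (siegelDeltaRat L e dV hdV dW hdW) (ratH L e dV hdV dW hdW)) (wq ν) :
                SiegelDeltaQuot L e dV hdV dW hdW)))ᶜ : Set (SiegelDeltaQuot L e dV hdV dW hdW)),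
          f ((((Quotient.out (q : SiegelDeltaQuot L e dV hdV dW hdW) : ratH L e dV hdV dW hdW) : HA L e dV hdV dW hdW)) *
            ((u : HA L e dV hdV dW hdW) * (p * h)))) ∂νN =
      ((IdeleClassGroup.ideleNorm L (posRealIdele L r) : ℝ) : ℂ) *
        ∫ u, (β u).toReal •
          (∑' q : ↥(({Quotient.mk (MulAction.orbitRel (siegelDeltaRat L e dV hdV dW hdW) (ratH L e dV hdV dW hdW)) 1} ∪
              Set.range (fun ν : unipDeltaRat L e dV hdV dW hdW =>
                (Quotient.mk (MulAction.orbitRel (siegelDeltaRat L e dV hdV dW hdW) (ratH L e dV hdV dW hdW)) (wq ν) :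
                  SiegelDeltaQuot L e dV hdV dW hdW)))ᶜ : Set (SiegelDeltaQuot L e dV hdV dW hdW)),
            f ((((Quotient.out (q : SiegelDeltaQuot L e dV hdV dW hdW) : ratH L e dV hdV dW hdW) : HA L e dV hdV dW hdW)) *
              ((u : HA L e dV hdV dW hdW) * h))) ∂νN := by
  -- (H) at both base points and `hconj` for the Haar measure `νN`; ★ α3-2 at both points for the inner section `F` of `β₁`
  have hs' : ((2 : ℕ) : ℝ) / 2 < s.re := by rw [Nat.cast_ofNat]; linarith
  have hconj := fun g : GL (Fin 2) L => measurePreserving_conj_levi Λ hΛ hdV0 hdW0 νN g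
  have hmid : ∀ x : HA L e dV hdV dW hdW,
      ∫ u, (β u).toReal •
          (∑' q : ↥(({Quotient.mk (MulAction.orbitRel (siegelDeltaRat L e dV hdV dW hdW) (ratH L e dV hdV dW hdW)) 1} ∪
              Set.range (fun ν : unipDeltaRat L e dV hdV dW hdW =>
                (Quotient.mk (MulAction.orbitRel (siegelDeltaRat L e dV hdV dW hdW) (ratH L e dV hdV dW hdW)) (wq ν) :
                  SiegelDeltaQuot L e dV hdV dW hdW)))ᶜ : Set (SiegelDeltaQuot L e dV hdV dW hdW)),
            f ((((Quotient.out (q : SiegelDeltaQuot L e dV hdV dW hdW) : ratH L e dV hdV dW hdW) : HA L e dV hdV dW hdW)) *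
              ((u : HA L e dV hdV dW hdW) * x))) ∂νN =
        ∑' q : Projectivization L (Fin 2 → L),
          (fun y : HA L e dV hdV dW hdW => ∫ u, (β₁ u).toReal •
              f (iotaGG L e dV hdV dW hdW (1, UnitaryGroup.rationalPairToAdelic (Fp L) L (IsCMField.complexConj L) N M (Matrix.diagonal dV) (Matrix.diagonal dW) g₀) *
                ((u : HA L e dV hdV dW hdW) * y)) ∂νN)
            (Λ (Matrix.GeneralLinearGroup.map (algebraMap L (AdeleRing (𝓞 L) L)) (γ q)) * x) := fun x =>
    (middle_cell_eq_tsum hg₀ Λ hΛ Γ₀ hΓ₀ wq hwq hdV0 hdW0 νN hβ hf hfc x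
      (lintegral_tsum_enorm_mul_weight_ne_top L e dV hdV dW hdW hdV0 hdW0 hχ hs' hf hfc νN hβtop hK hβK x) hβ₁ hconj _ (fun _ => rfl) γ hγ).1
  rw [hmid (p * h), hmid h, ← tsum_mul_left]
  refine tsum_congr fun q => ?_
  -- `p = Λ(z·1)` commutes with `Λ γ̂_q`; §2 term by term
  have hpz : p = Λ (glDiagonal 2 (AdeleRing (𝓞 L) L) (fun _ => posRealIdele L r)) :=
    levi_scalar_eq_of_blk_eq Λ hΛ hdV0 hdW0 (DoubledUnitary.RankOneReduction.conjAdele_posRealIdele (Fp L) L (IsCMField.complexConj L) r) hp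
  dsimp only
  rw [hpz, levi_mul_scalar_mul]
  exact innerSection_centralRay hg₀ Λ hΛ Γ₀ hΓ₀ hdV0 hdW0 νN hβ₁ hf hfc _ (fun _ => rfl) r _

include hwq hg₀ hΛ hΓ₀ in
/-- **(M) §3 — THE MIDDLE-CELL CENTRAL-RAY LAW ON THE CONVERGENCE HALF-PLANE.**  `νN` a Haar measure on `N_Δ(𝔸)`, `β` an `N_Δ(L⁺)`-covering weight with `∫⁻ β < ∞` and
`β ≤ 𝟙_K` (`K` compact), `χ` unitary, `1 < re s` (`= n∕2`), `f ∈ I_Δ(s, χ)` continuous, `r : ℝ≥0ˣ`, and ANY `p ∈ H(𝔸)` whose block matrix is the scalar Levi matrix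
`diag(z(r)·1, z(r)⁻¹·1)` (★ W4-ray `eq_zero_of_isSiegelDeltaSection_add_centralRay_eigen`'s `h₂` quantifier at `n = 2`).  THEN, for every `h ∈ H(𝔸)`,
  `∫ β(u) • Σ'_{q ∈ REST} f(γ_q·(u·(p·h))) dνN(u) = |z(r)|_𝔸 · ∫ β(u) • Σ'_{q ∈ REST} f(γ_q·(u·h)) dνN(u)`
(the integral = ★ I4 `exists_middleTerm_package'` clause (iii) VERBATIM).  §3a with the stabiliser weight = the Literature `unfoldWeight` of `β` over a section of `Γ₀\N_Δ(L⁺)`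
(★ `exists_section_of_orbit` at `γ₀ = w₀`, Literature `coveringSum_unfoldWeight`) and a row section ★ `exists_rowSection₂` — NO letter beyond α3-2's datum and the carrier.
[cite: MoeglinWaldspurger1995, II.1.7] [cite: KudlaRallis1994, §2 (2.10)–(2.12)] [cite: JiangWu2016ChiB, Prop. 4.1] -/
theorem middleTerm_centralRay (hdV0 : ∀ i, dV i ≠ 0) (hdW0 : ∀ i, dW i ≠ 0) (νN : Measure (unipDelta L e dV hdV dW hdW)) [νN.IsHaarMeasure]
    {β : unipDelta L e dV hdV dW hdW → ℝ≥0∞} (hβ : IsCoveringWeight (unipDeltaRat L e dV hdV dW hdW) β) (hβtop : ∫⁻ u, β u ∂νN ≠ ∞)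
    {K : Set (unipDelta L e dV hdV dW hdW)} (hK : IsCompact K) (hβK : ∀ u, β u ≤ K.indicator 1 u)
    {χ : HeckeCharacter L} (hχ : χ.IsUnitary) {s : ℂ} (hs : 1 < s.re) {f : HA L e dV hdV dW hdW → ℂ} (hf : IsSiegelDeltaSection L e dV hdV dW hdW χ s f) (hfc : Continuous f)
    (r : ℝ≥0ˣ) {p : HA L e dV hdV dW hdW}
    (hp : blk L e dV hdV dW hdW p =
      cayR (AdeleRing (𝓞 L) L) (Fin 2) *
        Matrix.fromBlocks (((posRealIdele L r : (AdeleRing (𝓞 L) L)ˣ) : AdeleRing (𝓞 L) L) • (1 : Matrix (Fin 2) (Fin 2) (AdeleRing (𝓞 L) L))) 0 0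
          ((((posRealIdele L r)⁻¹ : (AdeleRing (𝓞 L) L)ˣ) : AdeleRing (𝓞 L) L) • (1 : Matrix (Fin 2) (Fin 2) (AdeleRing (𝓞 L) L))) *
        cayRinv (AdeleRing (𝓞 L) L) (Fin 2))
    (h : HA L e dV hdV dW hdW) :
    ∫ u, (β u).toReal •
        (∑' q : ↥(({Quotient.mk (MulAction.orbitRel (siegelDeltaRat L e dV hdV dW hdW) (ratH L e dV hdV dW hdW)) 1} ∪
            Set.range (fun ν : unipDeltaRat L e dV hdV dW hdW =>
              (Quotient.mk (MulAction.orbitRel (siegelDeltaRat L e dV hdV dW hdW) (ratH L e dV hdV dW hdW)) (wq ν) :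
                SiegelDeltaQuot L e dV hdV dW hdW)))ᶜ : Set (SiegelDeltaQuot L e dV hdV dW hdW)),
          f ((((Quotient.out (q : SiegelDeltaQuot L e dV hdV dW hdW) : ratH L e dV hdV dW hdW) : HA L e dV hdV dW hdW)) *
            ((u : HA L e dV hdV dW hdW) * (p * h)))) ∂νN =
      ((IdeleClassGroup.ideleNorm L (posRealIdele L r) : ℝ) : ℂ) *
        ∫ u, (β u).toReal •
          (∑' q : ↥(({Quotient.mk (MulAction.orbitRel (siegelDeltaRat L e dV hdV dW hdW) (ratH L e dV hdV dW hdW)) 1} ∪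
              Set.range (fun ν : unipDeltaRat L e dV hdV dW hdW =>
                (Quotient.mk (MulAction.orbitRel (siegelDeltaRat L e dV hdV dW hdW) (ratH L e dV hdV dW hdW)) (wq ν) :
                  SiegelDeltaQuot L e dV hdV dW hdW)))ᶜ : Set (SiegelDeltaQuot L e dV hdV dW hdW)),
            f ((((Quotient.out (q : SiegelDeltaQuot L e dV hdV dW hdW) : ratH L e dV hdV dW hdW) : HA L e dV hdV dW hdW)) *
              ((u : HA L e dV hdV dW hdW) * h))) ∂νN := by
  classical
  haveI : Countable (ratH L e dV hdV dW hdW) := countable_ratH L e dV hdV dW hdW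
  haveI : Countable (SiegelDeltaQuot L e dV hdV dW hdW) := by unfold SiegelDeltaQuot; exact inferInstance
  haveI : MeasurableConstSMul (unipDelta L e dV hdV dW hdW) (unipDelta L e dV hdV dW hdW) := ⟨fun g => measurable_const_mul g⟩
  -- a `Γ₀`-covering weight: the unfolded weight of `β` over a section of `Γ₀\N_Δ(L⁺)` (★ `exists_section_of_orbit` at `γ₀ = w₀`)
  have hΓ₀le : Γ₀ ≤ (ratH L e dV hdV dW hdW).subgroupOf (unipDelta L e dV hdV dW hdW) := fun u hu => Subgroup.mem_subgroupOf.2 ((hΓ₀ u).1 hu).1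
  set γ₀ : ratH L e dV hdV dW hdW := ⟨iotaGG L e dV hdV dW hdW (1, UnitaryGroup.rationalPairToAdelic (Fp L) L (IsCMField.complexConj L) N M (Matrix.diagonal dV) (Matrix.diagonal dW) g₀),
      iotaGG_one_mem_ratH L e dV hdV dW hdW g₀⟩ with hγ₀
  have hΓ' : ∀ u : unipDelta L e dV hdV dW hdW, u ∈ Γ₀ ↔ (u : HA L e dV hdV dW hdW) ∈ ratH L e dV hdV dW hdW ∧
      IsSiegelDelta L e dV hdV dW hdW ((γ₀ : HA L e dV hdV dW hdW) * (u : HA L e dV hdV dW hdW) * ((γ₀ : HA L e dV hdV dW hdW))⁻¹) := hΓ₀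
  obtain ⟨ν, -, hν⟩ := exists_section_of_orbit γ₀ Γ₀ hΓ'
  have hβ₁ : IsCoveringWeight Γ₀ (unfoldWeight β (fun q => ((ν q : (ratH L e dV hdV dW hdW).subgroupOf (unipDelta L e dV hdV dW hdW)) : unipDelta L e dV hdV dW hdW))) := by
    refine ⟨measurable_unfoldWeight hβ.1 _, fun u => ?_⟩
    rw [coveringSum_unfoldWeight ((ratH L e dV hdV dW hdW).subgroupOf (unipDelta L e dV hdV dW hdW)) Γ₀ hΓ₀le β (fun q => (ν q).2) hν u]
    exact hβ.2 u
  -- a row section of `ℙ¹(L)`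
  obtain ⟨γ, hγ, -⟩ := exists_rowSection₂ (K := L)
  exact middleTerm_centralRay_of_weight hg₀ Λ hΛ Γ₀ hΓ₀ wq hwq hdV0 hdW0 νN hβ hβtop hK hβK hχ hs hf hfc hβ₁ γ hγ r hp h

omit [MeasurableSpace (unipDelta L e dV hdV dW hdW)] [BorelSpace (unipDelta L e dV hdV dW hdW)] in
/-- **`modΔ(p) = |z(r)|_𝔸` at `n = 2`** for the scalar Levi element of the ray (★ S5-W4 `modDelta_of_blk_eq_levi_scalar`: `modΔ(p) = √|z²|_𝔸`).
[cite: HarrisKudlaSweet1996, §1 (1.11)] [cite: MoeglinWaldspurger1995, II.1.6] -/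
theorem modDelta_centralRay_two (r : ℝ≥0ˣ) {p : HA L e dV hdV dW hdW}
    (hp : blk L e dV hdV dW hdW p =
      cayR (AdeleRing (𝓞 L) L) (Fin 2) *
        Matrix.fromBlocks (((posRealIdele L r : (AdeleRing (𝓞 L) L)ˣ) : AdeleRing (𝓞 L) L) • (1 : Matrix (Fin 2) (Fin 2) (AdeleRing (𝓞 L) L))) 0 0
          ((((posRealIdele L r)⁻¹ : (AdeleRing (𝓞 L) L)ˣ) : AdeleRing (𝓞 L) L) • (1 : Matrix (Fin 2) (Fin 2) (AdeleRing (𝓞 L) L))) *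
        cayRinv (AdeleRing (𝓞 L) L) (Fin 2)) :
    modDelta L e dV hdV dW hdW p = (IdeleClassGroup.ideleNorm L (posRealIdele L r) : ℝ) := by
  rw [modDelta_of_blk_eq_levi_scalar L e dV hdV dW hdW hp, ← coe_ideleNorm, map_pow, NNReal.coe_pow, Real.sqrt_sq (NNReal.coe_nonneg _)]

include hwq hg₀ hΛ hΓ₀ in
/-- **(M) §3′ — THE SAME LAW WITH THE EIGENVALUE WRITTEN `modΔ(p)¹`** (exponent `1` of the table «3 ∣ 1 ∣ 1» at `n = 2`).
[cite: MoeglinWaldspurger1995, II.1.7] [cite: JiangWu2016ChiB, Prop. 4.1] -/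
theorem middleTerm_centralRay_modDelta (hdV0 : ∀ i, dV i ≠ 0) (hdW0 : ∀ i, dW i ≠ 0) (νN : Measure (unipDelta L e dV hdV dW hdW)) [νN.IsHaarMeasure]
    {β : unipDelta L e dV hdV dW hdW → ℝ≥0∞} (hβ : IsCoveringWeight (unipDeltaRat L e dV hdV dW hdW) β) (hβtop : ∫⁻ u, β u ∂νN ≠ ∞)
    {K : Set (unipDelta L e dV hdV dW hdW)} (hK : IsCompact K) (hβK : ∀ u, β u ≤ K.indicator 1 u)
    {χ : HeckeCharacter L} (hχ : χ.IsUnitary) {s : ℂ} (hs : 1 < s.re) {f : HA L e dV hdV dW hdW → ℂ} (hf : IsSiegelDeltaSection L e dV hdV dW hdW χ s f) (hfc : Continuous f)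
    (r : ℝ≥0ˣ) {p : HA L e dV hdV dW hdW}
    (hp : blk L e dV hdV dW hdW p =
      cayR (AdeleRing (𝓞 L) L) (Fin 2) *
        Matrix.fromBlocks (((posRealIdele L r : (AdeleRing (𝓞 L) L)ˣ) : AdeleRing (𝓞 L) L) • (1 : Matrix (Fin 2) (Fin 2) (AdeleRing (𝓞 L) L))) 0 0
          ((((posRealIdele L r)⁻¹ : (AdeleRing (𝓞 L) L)ˣ) : AdeleRing (𝓞 L) L) • (1 : Matrix (Fin 2) (Fin 2) (AdeleRing (𝓞 L) L))) *
        cayRinv (AdeleRing (𝓞 L) L) (Fin 2))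
    (h : HA L e dV hdV dW hdW) :
    ∫ u, (β u).toReal •
        (∑' q : ↥(({Quotient.mk (MulAction.orbitRel (siegelDeltaRat L e dV hdV dW hdW) (ratH L e dV hdV dW hdW)) 1} ∪
            Set.range (fun ν : unipDeltaRat L e dV hdV dW hdW =>
              (Quotient.mk (MulAction.orbitRel (siegelDeltaRat L e dV hdV dW hdW) (ratH L e dV hdV dW hdW)) (wq ν) :
                SiegelDeltaQuot L e dV hdV dW hdW)))ᶜ : Set (SiegelDeltaQuot L e dV hdV dW hdW)),
          f ((((Quotient.out (q : SiegelDeltaQuot L e dV hdV dW hdW) : ratH L e dV hdV dW hdW) : HA L e dV hdV dW hdW)) *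
            ((u : HA L e dV hdV dW hdW) * (p * h)))) ∂νN =
      ((modDelta L e dV hdV dW hdW p : ℝ) : ℂ) *
        ∫ u, (β u).toReal •
          (∑' q : ↥(({Quotient.mk (MulAction.orbitRel (siegelDeltaRat L e dV hdV dW hdW) (ratH L e dV hdV dW hdW)) 1} ∪
              Set.range (fun ν : unipDeltaRat L e dV hdV dW hdW =>
                (Quotient.mk (MulAction.orbitRel (siegelDeltaRat L e dV hdV dW hdW) (ratH L e dV hdV dW hdW)) (wq ν) :
                  SiegelDeltaQuot L e dV hdV dW hdW)))ᶜ : Set (SiegelDeltaQuot L e dV hdV dW hdW)),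
            f ((((Quotient.out (q : SiegelDeltaQuot L e dV hdV dW hdW) : ratH L e dV hdV dW hdW) : HA L e dV hdV dW hdW)) *
              ((u : HA L e dV hdV dW hdW) * h))) ∂νN := by
  rw [modDelta_centralRay_two r hp]
  exact middleTerm_centralRay hg₀ Λ hΛ Γ₀ hΓ₀ wq hwq hdV0 hdW0 νN hβ hβtop hK hβK hχ hs hf hfc r hp h

/-! ## §4 Family form and the continued middle term `E₇` on the half-plane (the `hrayM` letter) -/

include hwq hg₀ hΛ hΓ₀ in
/-- **(M) §4 — THE CONTINUED MIDDLE TERM IS A CENTRAL-RAY EIGENFUNCTION ON THE HALF-PLANE (the `hrayM` letter).**  For ANY `E₇ : ℂ → H(𝔸) → ℂ` that agrees on `1 < re s`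
with `(∏_{p ∈ {½}} (s − p)) · MID_s` (★ I4 `exists_middleTerm_package'` clause (iii), read at `n = 2`):
`∀ s, 1 < re s → ∀ r p, blk p = diag(z(r)·1, z(r)⁻¹·1) → ∀ h, E₇ s (p·h) = |z(r)|_𝔸 · E₇ s h` — ready for the identity theorem in `s` (the eigenvalue does not depend on `s`).
[cite: MoeglinWaldspurger1995, II.1.7] [cite: JiangWu2016ChiB, Prop. 4.1] -/
theorem middleContinuation_centralRay (hdV0 : ∀ i, dV i ≠ 0) (hdW0 : ∀ i, dW i ≠ 0) (νN : Measure (unipDelta L e dV hdV dW hdW)) [νN.IsHaarMeasure]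
    {β : unipDelta L e dV hdV dW hdW → ℝ≥0∞} (hβ : IsCoveringWeight (unipDeltaRat L e dV hdV dW hdW) β) (hβtop : ∫⁻ u, β u ∂νN ≠ ∞)
    {K : Set (unipDelta L e dV hdV dW hdW)} (hK : IsCompact K) (hβK : ∀ u, β u ≤ K.indicator 1 u)
    {χ : HeckeCharacter L} (hχ : χ.IsUnitary) (f : ℂ → HA L e dV hdV dW hdW → ℂ)
    (hf : ∀ s : ℂ, IsSiegelDeltaSection L e dV hdV dW hdW χ s (f s)) (hfc : ∀ s : ℂ, Continuous (f s))
    (E₇ : ℂ → HA L e dV hdV dW hdW → ℂ)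
    (hE₇ : ∀ (s : ℂ) (h : HA L e dV hdV dW hdW), 1 < s.re →
      E₇ s h = (∏ p ∈ ({(1 / 2 : ℂ)} : Finset ℂ), (s - p)) * ∫ u, (β u).toReal •
        (∑' q : ↥(({Quotient.mk (MulAction.orbitRel (siegelDeltaRat L e dV hdV dW hdW) (ratH L e dV hdV dW hdW)) 1} ∪
            Set.range (fun ν : unipDeltaRat L e dV hdV dW hdW =>
              (Quotient.mk (MulAction.orbitRel (siegelDeltaRat L e dV hdV dW hdW) (ratH L e dV hdV dW hdW)) (wq ν) :
                SiegelDeltaQuot L e dV hdV dW hdW)))ᶜ : Set (SiegelDeltaQuot L e dV hdV dW hdW)),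
          f s ((((Quotient.out (q : SiegelDeltaQuot L e dV hdV dW hdW) : ratH L e dV hdV dW hdW) : HA L e dV hdV dW hdW)) *
            ((u : HA L e dV hdV dW hdW) * h))) ∂νN) :
    ∀ s : ℂ, 1 < s.re → ∀ (r : ℝ≥0ˣ) (p : HA L e dV hdV dW hdW),
      blk L e dV hdV dW hdW p =
        cayR (AdeleRing (𝓞 L) L) (Fin 2) *
          Matrix.fromBlocks (((posRealIdele L r : (AdeleRing (𝓞 L) L)ˣ) : AdeleRing (𝓞 L) L) • (1 : Matrix (Fin 2) (Fin 2) (AdeleRing (𝓞 L) L))) 0 0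
            ((((posRealIdele L r)⁻¹ : (AdeleRing (𝓞 L) L)ˣ) : AdeleRing (𝓞 L) L) • (1 : Matrix (Fin 2) (Fin 2) (AdeleRing (𝓞 L) L))) *
          cayRinv (AdeleRing (𝓞 L) L) (Fin 2) →
      ∀ h : HA L e dV hdV dW hdW, E₇ s (p * h) = ((IdeleClassGroup.ideleNorm L (posRealIdele L r) : ℝ) : ℂ) * E₇ s h := by
  intro s hs r p hp h
  rw [hE₇ s (p * h) hs, hE₇ s h hs, middleTerm_centralRay hg₀ Λ hΛ Γ₀ hΓ₀ wq hwq hdV0 hdW0 νN hβ hβtop hK hβK hχ hs (hf s) (hfc s) r hp h]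
  ring

end Two

end Summit.HodgeConjecture.HodgeConjecture.Cruxes.HLiu418.K2LiuSiegelMiddleTermCentralRay

end
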